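import Literature.Analysis.Potential.HalfPlanePoissonBoundary

/-!
# `KkBandLift` (crux stmt-HubbardSuperconductivity-10402, route `KkFloor`) — negative side:
# Poisson minorisation of a subharmonic function at ONE interior point of the right half-plane

Refuter file (B2b-4, HONEST FRAMING: the value here is a THEOREM — a kernel-checked ingredient of
`¬ KkBandLift` — not summit progress).

`lintegral_poisson_le_of_subharmonic`: if `u ≤ 0` on the closed right half-plane, `x > 0`,
`-γ ≤ u(x)`, and the Cayley pull-back `ζ ↦ u(x(1+ζ)/(1-ζ))` is subharmonic off the pole `ζ = 1`,
then `∫ (-u(iy)) · x/(x²+y²) dy ≤ πγ` — the Poisson-integral minorisation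
`u(x) ≤ (1/π) ∫ u(iy) x (x²+y²)⁻¹ dy` at the single point `x`.

EXTRACTION: this is LITERALLY `have stepA` inside the proof of
`Literature.Analysis.Potential.lintegral_boundary_le_of_subharmonic` (sub-mean-value inequality on
the circles `|ζ| = r < 1` of the Cayley disc, Fatou as `r → 1` by upper semicontinuity at the
boundary, change of variables `y = x cot(θ/2)` = `Literature.Analysis.Potential.lintegral_cayley_subst`),
with the ONE-POINT hypothesis `-γ ≤ u(x)` in place of `-xβ ≤ u(x) ∀ x > 0`; that Literature
theorem (the engine of the route's proved `KkFloorTheorem`) is the `x → 0⁺` limit (its steps B–C).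
Used by `FiniteXFloor.lean` (N1 of `Cruxes/KkBandLift/StrategistNegation.lean`).

Source: T. Ransford, *Potential Theory in the Complex Plane* (1995) §2.3–2.4 [Ransford1995];
P. Koosis, *The Logarithmic Integral* I, Ch. III (half-plane Poisson kernel). Folklore; no
definition is introduced.
-/

set_option linter.dupNamespace false

noncomputable section

namespace Summit.HubbardSuperconductivity.HubbardSuperconductivity.Theorems.KkBandLift.Negative

open Complex MeasureTheory Set Filter Metric
open scoped Real Topology ENNReal
open Literature.Analysis.Pluripotential Literature.Analysis.Potential

/-! ### Poisson minorisation at one interior point of the right half-plane -/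

/-- **Poisson minorisation at fixed height.** Let `u ≤ 0` on the closed right half-plane, let
`x > 0` with `-γ ≤ u(x)`, and suppose the Cayley pull-back `ζ ↦ u(x(1+ζ)/(1-ζ))` is subharmonic
off the pole `ζ = 1`. Then `∫ (-u(iy)) · 2x/(x²+y²) dy ≤ 2πγ` (sub-mean-value inequality at the
centre of the circles `|ζ| = r < 1`, Fatou as `r → 1` using upper semicontinuity at the boundary,
and `dθ = 2x(x²+y²)⁻¹ dy` under `y = x cot(θ/2)`). Extracted from `stepA` of
`Literature.Analysis.Potential.lintegral_boundary_le_of_subharmonic`. [cite: Ransford1995, §2.4] -/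
theorem lintegral_poisson_two_le_of_subharmonic (u : ℂ → EReal) (x γ : ℝ) (hx0 : 0 < x)
    (h0 : ∀ z : ℂ, 0 ≤ z.re → u z ≤ 0)
    (hx : ((-γ : ℝ) : EReal) ≤ u x)
    (hsub : IsSubharmonicOn (fun ζ => u ((x : ℂ) * ((1 + ζ) / (1 - ζ)))) {ζ | ζ ≠ 1}) :
    ∫⁻ y : ℝ, (-u (I * y)).toENNReal * ENNReal.ofReal (2 * x / (x ^ 2 + y ^ 2)) ≤
      ENNReal.ofReal (2 * π * γ) := by
  set H : ℝ → ℝ≥0∞ := fun y => (-u (I * y)).toENNReal with hH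
  have hsin : ∀ θ ∈ Ioo (0:ℝ) (2 * π), Real.sin (θ / 2) ≠ 0 := by
    intro θ hθ
    exact (Real.sin_pos_of_pos_of_lt_pi (by linarith [hθ.1]) (by linarith [hθ.2])).ne'
  set w : ℂ → EReal := fun ζ => u ((x : ℂ) * ((1 + ζ) / (1 - ζ))) with hw_def
  have hw : IsSubharmonicOn w {ζ | ζ ≠ 1} := hsub
  have hw0 : ∀ ζ : ℂ, ‖ζ‖ ≤ 1 → ζ ≠ 1 → w ζ ≤ 0 := by
    intro ζ hζ h1
    refine h0 _ ?_
    rw [Complex.re_ofReal_mul]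
    exact mul_nonneg hx0.le (re_cayley_nonneg hζ h1)
  have hmemU : ∀ r : ℝ, 0 ≤ r → r < 1 → ∀ θ : ℝ, circleMap 0 r θ ∈ {ζ : ℂ | ζ ≠ 1} := by
    intro r hr hr1 θ h1
    have : ‖circleMap 0 r θ‖ = 1 := by rw [show circleMap 0 r θ = 1 from h1]; simp
    rw [circleMap_zero, norm_mul, Complex.norm_real, Real.norm_eq_abs, abs_of_nonneg hr,
      Complex.norm_exp_ofReal_mul_I, mul_one] at this
    linarith
  -- the lower-mean bound on every circle `|ζ| = r < 1`
  have hmean : ∀ r : ℝ, 0 < r → r < 1 →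
      ∫⁻ θ in Ioc (0:ℝ) (2 * π), (-w (circleMap 0 r θ)).toENNReal ≤
        ENNReal.ofReal (2 * π * γ) := by
    intro r hr hr1
    have hsub' : closedBall (0:ℂ) r ⊆ {ζ | ζ ≠ 1} := by
      intro ζ hζ h1
      rw [mem_closedBall, dist_zero_right, show ζ = 1 from h1, norm_one] at hζ
      linarith
    have hmv := hw.le_circleMean hr hsub'
    have hw0' : w 0 = u x := by simp [hw_def]
    have hup : circleUpperMean w 0 r = 0 := by
      unfold circleUpperMean
      have : (fun θ : ℝ => (w (circleMap 0 r θ)).toENNReal) = fun _ => 0 := by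
        funext θ
        refine EReal.toENNReal_of_nonpos (hw0 _ ?_ (hmemU r hr.le hr1 θ))
        rw [circleMap_zero, norm_mul, Complex.norm_real, Real.norm_eq_abs, abs_of_pos hr,
          Complex.norm_exp_ofReal_mul_I, mul_one]
        exact hr1.le
      rw [this, lintegral_zero, ENNReal.zero_div]
    have hcm : circleMean w 0 r = -((circleLowerMean w 0 r : ℝ≥0∞) : EReal) := by
      rw [circleMean, hup]
      simp
    have h1 : ((circleLowerMean w 0 r : ℝ≥0∞) : EReal) ≤ ((γ : ℝ) : EReal) := by
      have h := hx.trans (hw0' ▸ hmv)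
      rw [hcm, EReal.coe_neg, EReal.neg_le_neg_iff] at h
      exact h
    have h2 : circleLowerMean w 0 r ≤ ENNReal.ofReal γ := by
      rcases le_or_gt 0 γ with hγ | hγ
      · have : ((γ : ℝ) : EReal) = ((ENNReal.ofReal γ : ℝ≥0∞) : EReal) := by
          rw [EReal.coe_ennreal_ofReal, max_eq_left hγ]
        rw [this, EReal.coe_ennreal_le_coe_ennreal_iff] at h1
        exact h1
      · exfalso
        have h3 : (0 : EReal) ≤ ((circleLowerMean w 0 r : ℝ≥0∞) : EReal) := EReal.coe_ennreal_nonneg _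
        have h4 : ((γ : ℝ) : EReal) < 0 := by exact_mod_cast hγ
        exact (lt_irrefl (0 : EReal)) ((h3.trans h1).trans_lt h4)
    unfold circleLowerMean at h2
    have hpi0 : ENNReal.ofReal (2 * π) ≠ 0 := (ENNReal.ofReal_pos.2 (by positivity)).ne'
    rw [ENNReal.div_le_iff hpi0 ENNReal.ofReal_ne_top] at h2
    refine h2.trans_eq ?_
    rcases le_or_gt 0 γ with hγ | hγ
    · rw [← ENNReal.ofReal_mul hγ]
      congr 1
      ring
    · rw [ENNReal.ofReal_of_nonpos hγ.le, zero_mul, ENNReal.ofReal_of_nonpos]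
      nlinarith [Real.pi_pos]
  -- Fatou along `r_k → 1⁻`
  set rk : ℕ → ℝ := fun k => 1 - 1 / ((k : ℝ) + 2) with hrk_def
  have hrk : ∀ k, 0 < rk k ∧ rk k < 1 := by
    intro k
    have hk : (0:ℝ) < (k : ℝ) + 2 := by positivity
    constructor
    · simp only [hrk_def]
      rw [sub_pos, div_lt_one hk]
      linarith
    · simp only [hrk_def]
      have : 0 < 1 / ((k : ℝ) + 2) := by positivity
      linarith
  have hrk_lim : Tendsto rk atTop (𝓝 1) := by
    have h1 : Tendsto (fun k : ℕ => 1 / ((k : ℝ) + 2)) atTop (𝓝 0) := by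
      have := tendsto_one_div_add_atTop_nhds_zero_nat (𝕜 := ℝ)
      have h2 : Tendsto (fun k : ℕ => k + 1) atTop atTop := tendsto_add_atTop_nat 1
      have h3 := this.comp h2
      refine h3.congr fun k => ?_
      simp only [Function.comp_apply]
      push_cast
      ring_nf
    have : Tendsto (fun k : ℕ => (1:ℝ) - 1 / ((k : ℝ) + 2)) atTop (𝓝 (1 - 0)) :=
      tendsto_const_nhds.sub h1
    rw [sub_zero] at this
    exact this
  set G : ℕ → ℝ → ℝ≥0∞ := fun k θ => (-w (circleMap 0 (rk k) θ)).toENNReal with hG_def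
  have hGmeas : ∀ k, Measurable (G k) := fun k =>
    (measurable_comp_circleMap hw.1 (hmemU (rk k) (hrk k).1.le (hrk k).2)).neg.ereal_toENNReal
  have hfatou : ∫⁻ θ in Ioc (0:ℝ) (2 * π), liminf (fun k => G k θ) atTop ≤
      liminf (fun k => ∫⁻ θ in Ioc (0:ℝ) (2 * π), G k θ) atTop :=
    lintegral_liminf_le hGmeas
  have hbound : liminf (fun k => ∫⁻ θ in Ioc (0:ℝ) (2 * π), G k θ) atTop ≤
      ENNReal.ofReal (2 * π * γ) :=
    Filter.liminf_le_of_frequently_le'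
      (Eventually.of_forall fun k => hmean (rk k) (hrk k).1 (hrk k).2).frequently
  -- pointwise lower bound of the `liminf` by the boundary values (u.s.c. at the boundary)
  have hpt : ∀ θ ∈ Ioo (0:ℝ) (2 * π),
      (-w (circleMap 0 1 θ)).toENNReal ≤ liminf (fun k => G k θ) atTop := by
    intro θ hθ
    set ζ₀ : ℂ := circleMap 0 1 θ with hζ₀_def
    have hζ₀ : ζ₀ ≠ 1 := by
      intro h1
      rw [hζ₀_def, circleMap_zero, Complex.ofReal_one, one_mul, Complex.exp_eq_one_iff] at h1
      obtain ⟨n, hn⟩ := h1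
      have hθn : θ = n * (2 * π) := by
        have := congrArg Complex.im hn
        simpa using this
      have h1' : (0:ℝ) < n := by
        have : (0:ℝ) < n * (2 * π) := hθn ▸ hθ.1
        nlinarith [Real.pi_pos]
      have h2' : (n:ℝ) < 1 := by
        have : n * (2 * π) < 1 * (2 * π) := by rw [one_mul]; exact hθn ▸ hθ.2
        nlinarith [Real.pi_pos]
      have h3 : (0:ℤ) < n := by exact_mod_cast h1'
      have h4 : n < (1:ℤ) := by exact_mod_cast h2'
      omega
    have husc : UpperSemicontinuousWithinAt w {ζ | ζ ≠ 1} ζ₀ := hw.1 ζ₀ hζ₀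
    have htend : Tendsto (fun k => circleMap 0 (rk k) θ) atTop (𝓝[{ζ | ζ ≠ 1}] ζ₀) := by
      rw [tendsto_nhdsWithin_iff]
      constructor
      · have heq : (fun k => circleMap 0 (rk k) θ) = fun k => ((rk k : ℝ) : ℂ) * exp (θ * I) :=
          funext fun k => by rw [circleMap_zero]
        have hζ : ζ₀ = ((1:ℝ) : ℂ) * exp (θ * I) := by rw [hζ₀_def, circleMap_zero, Complex.ofReal_one]
        rw [heq, hζ]
        exact ((Complex.continuous_ofReal.tendsto 1).comp hrk_lim).mul_const _
      · exact Eventually.of_forall fun k => hmemU (rk k) (hrk k).1.le (hrk k).2 θ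
    have hlimsup : limsup (fun k => w (circleMap 0 (rk k) θ)) atTop ≤ w ζ₀ := by
      refine le_of_forall_gt_imp_ge_of_dense fun a ha => ?_
      exact Filter.limsup_le_of_le (by isBoundedDefault)
        ((htend.eventually (husc a ha)).mono fun k hk => hk.le)
    have hφ : (-w ζ₀).toENNReal ≤
        (-(limsup (fun k => w (circleMap 0 (rk k) θ)) atTop)).toENNReal :=
      EReal.toENNReal_le_toENNReal (EReal.neg_le_neg_iff.mpr hlimsup)
    refine hφ.trans_eq ?_
    have hanti : Antitone fun x : EReal => (-x).toENNReal := fun x y h =>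
      EReal.toENNReal_le_toENNReal (EReal.neg_le_neg_iff.mpr h)
    have := hanti.map_limsup_of_continuousAt (F := atTop)
      (fun k => w (circleMap 0 (rk k) θ))
      (EReal.continuous_toENNReal.comp continuous_neg).continuousAt
    simpa [Function.comp_def] using this
  -- boundary identification
  have hbdry : ∀ θ ∈ Ioo (0:ℝ) (2 * π),
      w (circleMap 0 1 θ) = u (I * ((x * (Real.cos (θ / 2) / Real.sin (θ / 2)) : ℝ) : ℂ)) := by
    intro θ hθ
    simp only [hw_def, circleMap_zero, Complex.ofReal_one, one_mul]
    rw [cayley_boundary θ (hsin θ hθ)]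
    push_cast
    ring_nf
  -- assemble
  calc ∫⁻ y, H y * ENNReal.ofReal (2 * x / (x ^ 2 + y ^ 2))
      = ∫⁻ θ in Ioo (0:ℝ) (2 * π), H (x * (Real.cos (θ / 2) / Real.sin (θ / 2))) :=
        (lintegral_cayley_subst x hx0 H).symm
    _ = ∫⁻ θ in Ioo (0:ℝ) (2 * π), (-w (circleMap 0 1 θ)).toENNReal :=
        setLIntegral_congr_fun measurableSet_Ioo fun θ hθ => by rw [hbdry θ hθ]
    _ ≤ ∫⁻ θ in Ioo (0:ℝ) (2 * π), liminf (fun k => G k θ) atTop :=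
        setLIntegral_mono' measurableSet_Ioo hpt
    _ ≤ ∫⁻ θ in Ioc (0:ℝ) (2 * π), liminf (fun k => G k θ) atTop :=
        lintegral_mono' (Measure.restrict_mono Ioo_subset_Ioc_self le_rfl) le_rfl
    _ ≤ liminf (fun k => ∫⁻ θ in Ioc (0:ℝ) (2 * π), G k θ) atTop := hfatou
    _ ≤ ENNReal.ofReal (2 * π * γ) := hbound

/-- **Poisson minorisation at fixed height, kernel `x/(x²+y²)`**: under the hypotheses of
`lintegral_poisson_two_le_of_subharmonic`, `∫ (-u(iy)) · x/(x²+y²) dy ≤ πγ`. [cite: Ransford1995, §2.4] -/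
theorem lintegral_poisson_le_of_subharmonic (u : ℂ → EReal) (x γ : ℝ) (hx0 : 0 < x)
    (h0 : ∀ z : ℂ, 0 ≤ z.re → u z ≤ 0)
    (hx : ((-γ : ℝ) : EReal) ≤ u x)
    (hsub : IsSubharmonicOn (fun ζ => u ((x : ℂ) * ((1 + ζ) / (1 - ζ)))) {ζ | ζ ≠ 1}) :
    ∫⁻ y : ℝ, (-u (I * y)).toENNReal * ENNReal.ofReal (x / (x ^ 2 + y ^ 2)) ≤
      ENNReal.ofReal (π * γ) := by
  have hA := lintegral_poisson_two_le_of_subharmonic u x γ hx0 h0 hx hsub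
  have heq : ∫⁻ y : ℝ, (-u (I * y)).toENNReal * ENNReal.ofReal (2 * x / (x ^ 2 + y ^ 2)) =
      2 * ∫⁻ y : ℝ, (-u (I * y)).toENNReal * ENNReal.ofReal (x / (x ^ 2 + y ^ 2)) := by
    rw [← lintegral_const_mul' _ _ ENNReal.ofNat_ne_top]
    refine lintegral_congr fun y => ?_
    rw [mul_left_comm, show (2 : ℝ≥0∞) = ENNReal.ofReal 2 by simp, ← ENNReal.ofReal_mul (by norm_num)]
    congr 2
    ring
  rw [heq, show ENNReal.ofReal (2 * π * γ) = 2 * ENNReal.ofReal (π * γ) by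
    rw [show (2 : ℝ≥0∞) = ENNReal.ofReal 2 by simp, ← ENNReal.ofReal_mul (by norm_num)]
    congr 1; ring] at hA
  exact (ENNReal.mul_le_mul_iff_right two_ne_zero ENNReal.ofNat_ne_top).mp hA


end Summit.HubbardSuperconductivity.HubbardSuperconductivity.Theorems.KkBandLift.Negative
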